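import Summits.HodgeConjecture.CorCM.IrreducibleOddWeightsCommutantDensityCMFields
import HarnessLib

/-!
# Density over the commutant, XI: THE D-RANK CALCULUS OF A JUXTAPOSITION — `r(b ⊔ b′) + m = r(b) + r(b′)`,
# diagonal orbit modules are modular up to the D-meet, and the class defect is `(r + r′ − r″) · dim A`

COR-CM (cell `pub-hodgecm2`, binder seat `b16` gen 73, count-neutral claim THE BICOMMUTANT AND HODGE DOMINATION,
file K5 — pure linear algebra (§1), abstract `G`-sets ∕ type ranks (§2), CM fields (§3); theorems only, no definition,
no named fact, no `sorry`).  NEW as stated, hence under `Summits/`.  HONEST FRAMING: Grassmann's formula for D-spans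
read through file C3's dimension formula `dim 𝔐(b)·δ = dim D⟨b⟩·dim A`; it rewrites gen 70's file I10 («the defect
is `(rank b + rank b′ − rank(b ⊔ b′))·d`», SCALAR commutant, ranks over `ℚ`) for an ARBITRARY commutant with D-RANKS
(`dim D⟨·⟩ = r·δ`) in place of ℚ-ranks.  Linear algebra and its reading on `dim MT(A₀ × A₁)` for abelian varieties with
complex multiplication; `HC_CM` is neither used nor asserted.

SETTING (files C1–C5).  `A` finite-dimensional stable irreducible with commutant `𝒟` (a parameter), `δ = dim D·a₀`;
tuples `b : J₀ → A`, `b′ : J₁ → A`, juxtaposition `b ⊔ b′ = Sum.elim b b′`; `D⟨b⟩ = ⨆_j D·b_j`; `𝔐(b) = span{(T_i b_j)_j}`.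

* §1 `D⟨b ⊔ b′⟩ = D⟨b⟩ + D⟨b′⟩` (`iSup_map_applyₗ_sum_elim`); Grassmann
  `dim D⟨b ⊔ b′⟩ + dim(D⟨b⟩ ∩ D⟨b′⟩) = dim D⟨b⟩ + dim D⟨b′⟩`; the D-RANKS `r, r′, r″, m` of `b`, `b′`, `b ⊔ b′` and of
  the meet with **`r″ + m = r + r′`** (`exists_rank_sum_elim`); **MODULARITY OF DIAGONAL ORBIT MODULES UP TO THE
  D-MEET**: `dim 𝔐(b ⊔ b′)·δ + dim(D⟨b⟩ ∩ D⟨b′⟩)·dim A = (dim 𝔐(b) + dim 𝔐(b′))·δ`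
  (`finrank_span_diag_orbit_sum_elim_mul_add_eq`), i.e. `dim 𝔐(b) + dim 𝔐(b′) − dim 𝔐(b ⊔ b′) = m·dim A`.
* §2 Type ranks, both shadows in ONE isotypic class (file C5's setting): **`(rank Φ₀ + rank Φ₁)·δ + dim D⟨b ⊔ b′⟩·dim A
  = (rank(Φ₀,Φ₁) + 1)·δ + (dim D⟨b⟩ + dim D⟨b′⟩)·dim A`** (`typeRank_add_typeRank_mul_add_eq_of_commutant`) and its
  D-rank form `rank Φ₀ + rank Φ₁ + r″·dim A = rank(Φ₀,Φ₁) + 1 + (r + r′)·dim A`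
  (`typeRank_add_typeRank_add_rank_mul_eq_of_commutant` — file I10 verbatim with D-ranks).
* §3 CM dress: **`dim Hg(A₀) + dim Hg(A₁) − dim Hg(A₀ × A₁) = (r + r′ − r″)·dim A`**, D-ranks of the component tuples.

## References

* [Lang2002] S. Lang, *Algebra*, 3rd ed., XVII §1 (modules over the commutant), XVII §3 (density).
* [Serre1977] J.-P. Serre, *Linear Representations of Finite Groups*, GTM 42, §2.6.
* [Gordon1999HodgeAVSurvey] B. B. Gordon, *A survey of the Hodge conjecture for abelian varieties*, §3, 7.5–7.7, 9.4.3.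
* [Deligne1982HodgeCycles] P. Deligne, *Hodge cycles on abelian varieties*, LNM 900, I §3 Ex. 3.7.
-/

set_option autoImplicit false

noncomputable section

open scoped BigOperators Classical

universe u u₀ u₁ v v' v'' vY w

namespace Summit.HodgeConjecture.CorCM.IrrOdd

/-! ### §1 D-spans of juxtapositions -/

section Juxtaposition

variable {V : Type v} [AddCommGroup V] [Module ℚ V] {ι : Type w} (T : ι → V →ₗ[ℚ] V)

omit [AddCommGroup V] [Module ℚ V] in
/-- **`D⟨b ⊔ b′⟩ = D⟨b⟩ + D⟨b′⟩`**. [folklore] -/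
theorem iSup_map_applyₗ_sum_elim [AddCommGroup V] [Module ℚ V] (𝒟 : Submodule ℚ (V →ₗ[ℚ] V))
    {J₀ : Type u₀} {J₁ : Type u₁} (b₀ : J₀ → V) (b₁ : J₁ → V) :
    (⨆ s, 𝒟.map (LinearMap.applyₗ (Sum.elim b₀ b₁ s))) =
      (⨆ j, 𝒟.map (LinearMap.applyₗ (b₀ j))) ⊔ ⨆ j, 𝒟.map (LinearMap.applyₗ (b₁ j)) := by
  rw [iSup_sum]
  rfl

/-- **GRASSMANN FOR D-SPANS: `dim D⟨b ⊔ b′⟩ + dim(D⟨b⟩ ∩ D⟨b′⟩) = dim D⟨b⟩ + dim D⟨b′⟩`** (tuples in the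
finite-dimensional `A`). [cite: Lang2002, XVII §1] -/
theorem finrank_iSup_map_applyₗ_sum_elim_add_finrank_inf {𝒟 : Submodule ℚ (V →ₗ[ℚ] V)} {A : Submodule ℚ V}
    [FiniteDimensional ℚ A]
    (h𝒟 : ∀ L : V →ₗ[ℚ] V, L ∈ 𝒟 ↔ (∀ a ∈ A, L a ∈ A) ∧ ∀ (i : ι) (a : V), a ∈ A → L (T i a) = T i (L a))
    {J₀ : Type u₀} {J₁ : Type u₁} {b₀ : J₀ → V} {b₁ : J₁ → V} (hb₀ : ∀ j, b₀ j ∈ A) (hb₁ : ∀ j, b₁ j ∈ A) :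
    Module.finrank ℚ ↥(⨆ s, 𝒟.map (LinearMap.applyₗ (Sum.elim b₀ b₁ s))) +
        Module.finrank ℚ ↥((⨆ j, 𝒟.map (LinearMap.applyₗ (b₀ j))) ⊓ ⨆ j, 𝒟.map (LinearMap.applyₗ (b₁ j))) =
      Module.finrank ℚ ↥(⨆ j, 𝒟.map (LinearMap.applyₗ (b₀ j))) +
        Module.finrank ℚ ↥(⨆ j, 𝒟.map (LinearMap.applyₗ (b₁ j))) := by
  haveI : FiniteDimensional ℚ ↥(⨆ j, 𝒟.map (LinearMap.applyₗ (b₀ j))) :=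
    Submodule.finiteDimensional_of_le (iSup_map_applyₗ_le T h𝒟 hb₀)
  haveI : FiniteDimensional ℚ ↥(⨆ j, 𝒟.map (LinearMap.applyₗ (b₁ j))) :=
    Submodule.finiteDimensional_of_le (iSup_map_applyₗ_le T h𝒟 hb₁)
  rw [iSup_map_applyₗ_sum_elim]
  exact Submodule.finrank_sup_add_finrank_inf_eq _ _

/-- A juxtaposition of tuples in `A` is a tuple in `A`. [folklore] -/
theorem sum_elim_mem {A : Submodule ℚ V} {J₀ : Type u₀} {J₁ : Type u₁} {b₀ : J₀ → V} {b₁ : J₁ → V}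
    (hb₀ : ∀ j, b₀ j ∈ A) (hb₁ : ∀ j, b₁ j ∈ A) : ∀ s, Sum.elim b₀ b₁ s ∈ A := by
  rintro (j | j) <;> [exact hb₀ j; exact hb₁ j]

/-- **THE D-RANKS OF A JUXTAPOSITION: `r″ + m = r + r′`** (`A` finite-dimensional stable irreducible, `T` closed
under composition with identity, `0 ≠ a₀ ∈ A`): `dim D⟨b⟩ = r·δ`, `dim D⟨b′⟩ = r′·δ`, `dim D⟨b ⊔ b′⟩ = r″·δ`,
`dim(D⟨b⟩ ∩ D⟨b′⟩) = m·δ` with **`r″ + m = r + r′`** (Grassmann over `D`, read over `ℚ`). [cite: Lang2002, XVII §1] -/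
theorem exists_rank_sum_elim {𝒟 : Submodule ℚ (V →ₗ[ℚ] V)} {A : Submodule ℚ V} [FiniteDimensional ℚ A]
    (h𝒟 : ∀ L : V →ₗ[ℚ] V, L ∈ 𝒟 ↔ (∀ a ∈ A, L a ∈ A) ∧ ∀ (i : ι) (a : V), a ∈ A → L (T i a) = T i (L a))
    (h1 : ∃ i₀ : ι, T i₀ = LinearMap.id) (hmul : ∀ i i' : ι, ∃ i'' : ι, T i'' = T i ∘ₗ T i')
    (hAst : ∀ (i : ι) (v : V), v ∈ A → T i v ∈ A)
    (hAirr : ∀ W : Submodule ℚ V, W ≤ A → W ≠ ⊥ → (∀ (i : ι) (v : V), v ∈ W → T i v ∈ W) → W = A)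
    {J₀ : Type u₀} {J₁ : Type u₁} [Fintype J₀] [Fintype J₁] {b₀ : J₀ → V} {b₁ : J₁ → V}
    (hb₀ : ∀ j, b₀ j ∈ A) (hb₁ : ∀ j, b₁ j ∈ A) {a₀ : V} (ha₀ : a₀ ∈ A) (h0 : a₀ ≠ 0) :
    ∃ r₀ r₁ r m : ℕ,
      Module.finrank ℚ ↥(⨆ j, 𝒟.map (LinearMap.applyₗ (b₀ j))) =
          r₀ * Module.finrank ℚ ↥(𝒟.map (LinearMap.applyₗ a₀)) ∧
        Module.finrank ℚ ↥(⨆ j, 𝒟.map (LinearMap.applyₗ (b₁ j))) =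
            r₁ * Module.finrank ℚ ↥(𝒟.map (LinearMap.applyₗ a₀)) ∧
          Module.finrank ℚ ↥(⨆ s, 𝒟.map (LinearMap.applyₗ (Sum.elim b₀ b₁ s))) =
              r * Module.finrank ℚ ↥(𝒟.map (LinearMap.applyₗ a₀)) ∧
            Module.finrank ℚ ↥((⨆ j, 𝒟.map (LinearMap.applyₗ (b₀ j))) ⊓ ⨆ j, 𝒟.map (LinearMap.applyₗ (b₁ j))) =
                m * Module.finrank ℚ ↥(𝒟.map (LinearMap.applyₗ a₀)) ∧
              r + m = r₀ + r₁ := by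
  obtain ⟨r₀, -, hr₀, -⟩ := exists_rank_finrank_eq T h𝒟 h1 hmul hAst hAirr hb₀ ha₀ h0
  obtain ⟨r₁, -, hr₁, -⟩ := exists_rank_finrank_eq T h𝒟 h1 hmul hAst hAirr hb₁ ha₀ h0
  obtain ⟨r, -, hr, -⟩ := exists_rank_finrank_eq T h𝒟 h1 hmul hAst hAirr (sum_elim_mem hb₀ hb₁) ha₀ h0
  obtain ⟨m, hm⟩ := finrank_map_applyₗ_dvd_finrank_iSup_inf_iSup T h𝒟 h1 hmul hAst hAirr ha₀ h0 b₁ hb₀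
  haveI : FiniteDimensional ℚ ↥(𝒟.map (LinearMap.applyₗ a₀)) :=
    Submodule.finiteDimensional_of_le (map_applyₗ_le T h𝒟 ha₀)
  have hδ : 0 < Module.finrank ℚ ↥(𝒟.map (LinearMap.applyₗ a₀)) :=
    Nat.pos_of_ne_zero fun h' => map_applyₗ_ne_bot T h𝒟 h0 (Submodule.finrank_eq_zero.1 h')
  refine ⟨r₀, r₁, r, m, hr₀, hr₁, hr, by rw [hm, mul_comm], ?_⟩
  have hG := finrank_iSup_map_applyₗ_sum_elim_add_finrank_inf T h𝒟 hb₀ hb₁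
  rw [hr₀, hr₁, hr, hm] at hG
  apply Nat.eq_of_mul_eq_mul_right hδ
  rw [add_mul, add_mul, ← hG]
  ring

/-- **DIAGONAL ORBIT MODULES ARE MODULAR UP TO THE D-MEET:
`dim 𝔐(b ⊔ b′)·δ + dim(D⟨b⟩ ∩ D⟨b′⟩)·dim A = (dim 𝔐(b) + dim 𝔐(b′))·δ`** — i.e.
`dim 𝔐(b) + dim 𝔐(b′) − dim 𝔐(b ⊔ b′) = m·dim A`, `m` the D-dimension of the meet of the D-spans (file C3's
dimension formula three times and Grassmann). [cite: Lang2002, XVII §3] [cite: Serre1977, §2.6] -/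
theorem finrank_span_diag_orbit_sum_elim_mul_add_eq {𝒟 : Submodule ℚ (V →ₗ[ℚ] V)} {A : Submodule ℚ V}
    [FiniteDimensional ℚ A]
    (h𝒟 : ∀ L : V →ₗ[ℚ] V, L ∈ 𝒟 ↔ (∀ a ∈ A, L a ∈ A) ∧ ∀ (i : ι) (a : V), a ∈ A → L (T i a) = T i (L a))
    (h1 : ∃ i₀ : ι, T i₀ = LinearMap.id) (hmul : ∀ i i' : ι, ∃ i'' : ι, T i'' = T i ∘ₗ T i')
    (hAst : ∀ (i : ι) (v : V), v ∈ A → T i v ∈ A)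
    (hAirr : ∀ W : Submodule ℚ V, W ≤ A → W ≠ ⊥ → (∀ (i : ι) (v : V), v ∈ W → T i v ∈ W) → W = A)
    {J₀ : Type u₀} {J₁ : Type u₁} [Fintype J₀] [Fintype J₁] {b₀ : J₀ → V} {b₁ : J₁ → V}
    (hb₀ : ∀ j, b₀ j ∈ A) (hb₁ : ∀ j, b₁ j ∈ A) {a₀ : V} (ha₀ : a₀ ∈ A) (h0 : a₀ ≠ 0) :
    Module.finrank ℚ ↥(Submodule.span ℚ (Set.range fun i : ι => fun s : J₀ ⊕ J₁ => T i (Sum.elim b₀ b₁ s))) *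
          Module.finrank ℚ ↥(𝒟.map (LinearMap.applyₗ a₀)) +
        Module.finrank ℚ ↥((⨆ j, 𝒟.map (LinearMap.applyₗ (b₀ j))) ⊓ ⨆ j, 𝒟.map (LinearMap.applyₗ (b₁ j))) *
          Module.finrank ℚ A =
      (Module.finrank ℚ ↥(Submodule.span ℚ (Set.range fun i : ι => fun j : J₀ => T i (b₀ j))) +
          Module.finrank ℚ ↥(Submodule.span ℚ (Set.range fun i : ι => fun j : J₁ => T i (b₁ j)))) *
        Module.finrank ℚ ↥(𝒟.map (LinearMap.applyₗ a₀)) := by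
  have hM := finrank_span_diag_orbit_mul_eq T h𝒟 h1 hmul hAst hAirr (sum_elim_mem hb₀ hb₁) ha₀ h0
  have hM₀ := finrank_span_diag_orbit_mul_eq T h𝒟 h1 hmul hAst hAirr hb₀ ha₀ h0
  have hM₁ := finrank_span_diag_orbit_mul_eq T h𝒟 h1 hmul hAst hAirr hb₁ ha₀ h0
  have hG := finrank_iSup_map_applyₗ_sum_elim_add_finrank_inf T h𝒟 hb₀ hb₁
  have key := congrArg (· * Module.finrank ℚ A) hG
  simp only [add_mul] at key
  rw [add_mul, hM, hM₀, hM₁, key]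

/-- D-rank form: with `r, r′, r″` the D-ranks of `b`, `b′`, `b ⊔ b′` (`dim 𝔐 = rank·dim A`, file C3) and `m` the
D-dimension of `D⟨b⟩ ∩ D⟨b′⟩`, **`dim 𝔐(b ⊔ b′) + m·dim A = dim 𝔐(b) + dim 𝔐(b′)`**. [cite: Lang2002, XVII §3] -/
theorem exists_finrank_span_diag_orbit_sum_elim_add_eq {𝒟 : Submodule ℚ (V →ₗ[ℚ] V)} {A : Submodule ℚ V}
    [FiniteDimensional ℚ A]
    (h𝒟 : ∀ L : V →ₗ[ℚ] V, L ∈ 𝒟 ↔ (∀ a ∈ A, L a ∈ A) ∧ ∀ (i : ι) (a : V), a ∈ A → L (T i a) = T i (L a))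
    (h1 : ∃ i₀ : ι, T i₀ = LinearMap.id) (hmul : ∀ i i' : ι, ∃ i'' : ι, T i'' = T i ∘ₗ T i')
    (hAst : ∀ (i : ι) (v : V), v ∈ A → T i v ∈ A)
    (hAirr : ∀ W : Submodule ℚ V, W ≤ A → W ≠ ⊥ → (∀ (i : ι) (v : V), v ∈ W → T i v ∈ W) → W = A)
    {J₀ : Type u₀} {J₁ : Type u₁} [Fintype J₀] [Fintype J₁] {b₀ : J₀ → V} {b₁ : J₁ → V}
    (hb₀ : ∀ j, b₀ j ∈ A) (hb₁ : ∀ j, b₁ j ∈ A) {a₀ : V} (ha₀ : a₀ ∈ A) (h0 : a₀ ≠ 0) :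
    ∃ m : ℕ,
      Module.finrank ℚ ↥((⨆ j, 𝒟.map (LinearMap.applyₗ (b₀ j))) ⊓ ⨆ j, 𝒟.map (LinearMap.applyₗ (b₁ j))) =
          m * Module.finrank ℚ ↥(𝒟.map (LinearMap.applyₗ a₀)) ∧
        Module.finrank ℚ ↥(Submodule.span ℚ (Set.range fun i : ι => fun s : J₀ ⊕ J₁ => T i (Sum.elim b₀ b₁ s))) +
            m * Module.finrank ℚ A =
          Module.finrank ℚ ↥(Submodule.span ℚ (Set.range fun i : ι => fun j : J₀ => T i (b₀ j))) +
            Module.finrank ℚ ↥(Submodule.span ℚ (Set.range fun i : ι => fun j : J₁ => T i (b₁ j))) := by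
  obtain ⟨m, hm⟩ := finrank_map_applyₗ_dvd_finrank_iSup_inf_iSup T h𝒟 h1 hmul hAst hAirr ha₀ h0 b₁ hb₀
  haveI : FiniteDimensional ℚ ↥(𝒟.map (LinearMap.applyₗ a₀)) :=
    Submodule.finiteDimensional_of_le (map_applyₗ_le T h𝒟 ha₀)
  have hδ : 0 < Module.finrank ℚ ↥(𝒟.map (LinearMap.applyₗ a₀)) :=
    Nat.pos_of_ne_zero fun h' => map_applyₗ_ne_bot T h𝒟 h0 (Submodule.finrank_eq_zero.1 h')
  refine ⟨m, by rw [hm, mul_comm], Nat.eq_of_mul_eq_mul_right hδ ?_⟩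
  have h := finrank_span_diag_orbit_sum_elim_mul_add_eq T h𝒟 h1 hmul hAst hAirr hb₀ hb₁ ha₀ h0
  rw [hm] at h
  rw [add_mul, ← h]
  ring

end Juxtaposition

/-! ### §2 Type ranks: the class defect in D-ranks -/

section TypeRank

open Literature.NumberTheory.ComplexMultiplication

variable {G : Type w} [Group G] {Y : Type vY} [MulAction G Y] [Fintype Y]
  {Y₀ : Type v'} [MulAction G Y₀] [Fintype Y₀] {Y₁ : Type v''} [MulAction G Y₁] [Fintype Y₁]
  {I : Type u} {E : I → Type v} [∀ i, MulAction G (E i)] [∀ i, Fintype (E i)] [Fintype I] [∀ i, Nonempty (E i)]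

/-- **THE CLASS DEFECT, RANK FORM, FOR ANY COMMUTANT**: in file C5's setting (two slots, equivariant pivots refining
the trace classes, both shadows `w₀ = Σ_j ι⁰_j(b_j)`, `w₁ = Σ_k ι¹_k(b′_k)` assembled from ONE reference stable
irreducible `A` with commutant `𝒟`, `δ = dim D·a₀`),
**`(rank Φ₀ + rank Φ₁)·δ + dim D⟨b ⊔ b′⟩·dim A = (rank(Φ₀,Φ₁) + 1)·δ + (dim D⟨b⟩ + dim D⟨b′⟩)·dim A`**.
[cite: Gordon1999HodgeAVSurvey, §3 Theorem, 7.5–7.7 and 9.4.3] [cite: Lang2002, XVII §3] -/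
theorem typeRank_add_typeRank_mul_add_eq_of_commutant {ρ : G} {Φ : ∀ i, Set (E i)}
    (h : ∀ i, IsCMTypeWith ρ (Φ i)) {i₀ i₁ : I} (hI : ∀ j, j = i₀ ∨ j = i₁) (h01 : i₀ ≠ i₁)
    (r₀ : E i₀ → Y₀) (r₁ : E i₁ → Y₁) (hr₀ : ∀ (g : G) (x : E i₀), r₀ (g • x) = g • r₀ x)
    (hr₁ : ∀ (g : G) (x : E i₁), r₁ (g • x) = g • r₁ x)
    (hfine₀ : ∀ x x' : E i₀, r₀ x = r₀ x' → ∃ n : G, (∀ y : E i₁, n • y = y) ∧ n • x = x')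
    (hfine₁ : ∀ x x' : E i₁, r₁ x = r₁ x' → ∃ n : G, (∀ y : E i₀, n • y = y) ∧ n • x = x')
    {A : Submodule ℚ (Y → ℚ)} {𝒟 : Submodule ℚ ((Y → ℚ) →ₗ[ℚ] (Y → ℚ))}
    (h𝒟 : ∀ L : (Y → ℚ) →ₗ[ℚ] (Y → ℚ), L ∈ 𝒟 ↔ (∀ a ∈ A, L a ∈ A) ∧
      ∀ (k : G) (a : Y → ℚ), a ∈ A → L (fun y => a (k • y)) = fun y => L a (k • y))
    (hAst : ∀ (k : G) (a : Y → ℚ), a ∈ A → (fun y => a (k • y)) ∈ A)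
    (hAirr : ∀ W : Submodule ℚ (Y → ℚ), W ≤ A → W ≠ ⊥ →
      (∀ (k : G) (f : Y → ℚ), f ∈ W → (fun y => f (k • y)) ∈ W) → W = A)
    {J₀ : Type u₀} {J₁ : Type u₁} [Fintype J₀] [Fintype J₁]
    (ι₀ : J₀ → ((Y → ℚ) →ₗ[ℚ] (Y₀ → ℚ))) (ι₁ : J₁ → ((Y → ℚ) →ₗ[ℚ] (Y₁ → ℚ)))
    (hι₀eq : ∀ (j : J₀) (k : G) (a : Y → ℚ), a ∈ A → ι₀ j (fun y => a (k • y)) = fun y => ι₀ j a (k • y))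
    (hι₁eq : ∀ (j : J₁) (k : G) (a : Y → ℚ), a ∈ A → ι₁ j (fun y => a (k • y)) = fun y => ι₁ j a (k • y))
    (hind₀ : ∀ f : J₀ → (Y → ℚ), (∀ j, f j ∈ A) → ∑ j, ι₀ j (f j) = 0 → ∀ j, f j = 0)
    (hind₁ : ∀ f : J₁ → (Y → ℚ), (∀ j, f j ∈ A) → ∑ j, ι₁ j (f j) = 0 → ∀ j, f j = 0)
    {b₀ : J₀ → (Y → ℚ)} {b₁ : J₁ → (Y → ℚ)} (hb₀ : ∀ j, b₀ j ∈ A) (hb₁ : ∀ j, b₁ j ∈ A)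
    (hw₀ : (fun y : Y₀ => ∑ x ∈ Finset.univ.filter (fun x => r₀ x = y), antiVec (Φ i₀) (1 : G) x) =
      ∑ j, ι₀ j (b₀ j))
    (hw₁ : (fun y : Y₁ => ∑ x ∈ Finset.univ.filter (fun x => r₁ x = y), antiVec (Φ i₁) (1 : G) x) =
      ∑ j, ι₁ j (b₁ j))
    {a₀ : Y → ℚ} (ha₀ : a₀ ∈ A) (h0 : a₀ ≠ 0) :
    (typeRank G (Φ i₀) + typeRank G (Φ i₁)) * Module.finrank ℚ ↥(𝒟.map (LinearMap.applyₗ a₀)) +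
        Module.finrank ℚ ↥(⨆ s, 𝒟.map (LinearMap.applyₗ (Sum.elim b₀ b₁ s))) * Module.finrank ℚ A =
      (typeRank G (sigmaType Φ) + 1) * Module.finrank ℚ ↥(𝒟.map (LinearMap.applyₗ a₀)) +
        (Module.finrank ℚ ↥(⨆ j, 𝒟.map (LinearMap.applyₗ (b₀ j))) +
            Module.finrank ℚ ↥(⨆ j, 𝒟.map (LinearMap.applyₗ (b₁ j)))) * Module.finrank ℚ A := by
  have hC := typeRank_add_typeRank_mul_eq_of_commutant h hI h01 r₀ r₁ hr₀ hr₁ hfine₀ hfine₁ h𝒟 hAst hAirr ι₀ ι₁ hι₀eq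
    hι₁eq hind₀ hind₁ hb₀ hb₁ hw₀ hw₁ ha₀ h0
  let T : G → (Y → ℚ) →ₗ[ℚ] (Y → ℚ) := fun k => LinearMap.funLeft ℚ ℚ (fun y : Y => k • y)
  haveI : FiniteDimensional ℚ A := Submodule.finiteDimensional_of_le le_top
  have hG := finrank_iSup_map_applyₗ_sum_elim_add_finrank_inf T (𝒟 := 𝒟) (A := A) (fun L => h𝒟 L) hb₀ hb₁
  have key := congrArg (· * Module.finrank ℚ A) hG
  simp only [add_mul] at key
  rw [hC, add_mul (Module.finrank ℚ ↥(⨆ j, 𝒟.map (LinearMap.applyₗ (b₀ j))))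
    (Module.finrank ℚ ↥(⨆ j, 𝒟.map (LinearMap.applyₗ (b₁ j)))) (Module.finrank ℚ A), ← key]
  ring

/-- **FILE I10 WITH D-RANKS**: there are `r, r′, r″` (the D-ranks of `b`, `b′`, `b ⊔ b′`: `dim D⟨·⟩ = rank·δ`) with
**`rank Φ₀ + rank Φ₁ + r″·dim A = rank(Φ₀,Φ₁) + 1 + (r + r′)·dim A`** — the defect
`dim Hg(A₀)+dim Hg(A₁)−dim Hg(A₀×A₁)` is `(r + r′ − r″)·dim A` for ANY irreducible class.
[cite: Gordon1999HodgeAVSurvey, §3 Theorem, 7.5–7.7 and 9.4.3] [cite: Lang2002, XVII §1 and §3] -/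
theorem typeRank_add_typeRank_add_rank_mul_eq_of_commutant {ρ : G} {Φ : ∀ i, Set (E i)}
    (h : ∀ i, IsCMTypeWith ρ (Φ i)) {i₀ i₁ : I} (hI : ∀ j, j = i₀ ∨ j = i₁) (h01 : i₀ ≠ i₁)
    (r₀ : E i₀ → Y₀) (r₁ : E i₁ → Y₁) (hr₀ : ∀ (g : G) (x : E i₀), r₀ (g • x) = g • r₀ x)
    (hr₁ : ∀ (g : G) (x : E i₁), r₁ (g • x) = g • r₁ x)
    (hfine₀ : ∀ x x' : E i₀, r₀ x = r₀ x' → ∃ n : G, (∀ y : E i₁, n • y = y) ∧ n • x = x')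
    (hfine₁ : ∀ x x' : E i₁, r₁ x = r₁ x' → ∃ n : G, (∀ y : E i₀, n • y = y) ∧ n • x = x')
    {A : Submodule ℚ (Y → ℚ)} {𝒟 : Submodule ℚ ((Y → ℚ) →ₗ[ℚ] (Y → ℚ))}
    (h𝒟 : ∀ L : (Y → ℚ) →ₗ[ℚ] (Y → ℚ), L ∈ 𝒟 ↔ (∀ a ∈ A, L a ∈ A) ∧
      ∀ (k : G) (a : Y → ℚ), a ∈ A → L (fun y => a (k • y)) = fun y => L a (k • y))
    (hAst : ∀ (k : G) (a : Y → ℚ), a ∈ A → (fun y => a (k • y)) ∈ A)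
    (hAirr : ∀ W : Submodule ℚ (Y → ℚ), W ≤ A → W ≠ ⊥ →
      (∀ (k : G) (f : Y → ℚ), f ∈ W → (fun y => f (k • y)) ∈ W) → W = A)
    {J₀ : Type u₀} {J₁ : Type u₁} [Fintype J₀] [Fintype J₁]
    (ι₀ : J₀ → ((Y → ℚ) →ₗ[ℚ] (Y₀ → ℚ))) (ι₁ : J₁ → ((Y → ℚ) →ₗ[ℚ] (Y₁ → ℚ)))
    (hι₀eq : ∀ (j : J₀) (k : G) (a : Y → ℚ), a ∈ A → ι₀ j (fun y => a (k • y)) = fun y => ι₀ j a (k • y))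
    (hι₁eq : ∀ (j : J₁) (k : G) (a : Y → ℚ), a ∈ A → ι₁ j (fun y => a (k • y)) = fun y => ι₁ j a (k • y))
    (hind₀ : ∀ f : J₀ → (Y → ℚ), (∀ j, f j ∈ A) → ∑ j, ι₀ j (f j) = 0 → ∀ j, f j = 0)
    (hind₁ : ∀ f : J₁ → (Y → ℚ), (∀ j, f j ∈ A) → ∑ j, ι₁ j (f j) = 0 → ∀ j, f j = 0)
    {b₀ : J₀ → (Y → ℚ)} {b₁ : J₁ → (Y → ℚ)} (hb₀ : ∀ j, b₀ j ∈ A) (hb₁ : ∀ j, b₁ j ∈ A)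
    (hw₀ : (fun y : Y₀ => ∑ x ∈ Finset.univ.filter (fun x => r₀ x = y), antiVec (Φ i₀) (1 : G) x) =
      ∑ j, ι₀ j (b₀ j))
    (hw₁ : (fun y : Y₁ => ∑ x ∈ Finset.univ.filter (fun x => r₁ x = y), antiVec (Φ i₁) (1 : G) x) =
      ∑ j, ι₁ j (b₁ j))
    {a₀ : Y → ℚ} (ha₀ : a₀ ∈ A) (h0 : a₀ ≠ 0) :
    ∃ rk₀ rk₁ rk : ℕ,
      Module.finrank ℚ ↥(⨆ j, 𝒟.map (LinearMap.applyₗ (b₀ j))) =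
          rk₀ * Module.finrank ℚ ↥(𝒟.map (LinearMap.applyₗ a₀)) ∧
        Module.finrank ℚ ↥(⨆ j, 𝒟.map (LinearMap.applyₗ (b₁ j))) =
            rk₁ * Module.finrank ℚ ↥(𝒟.map (LinearMap.applyₗ a₀)) ∧
          Module.finrank ℚ ↥(⨆ s, 𝒟.map (LinearMap.applyₗ (Sum.elim b₀ b₁ s))) =
              rk * Module.finrank ℚ ↥(𝒟.map (LinearMap.applyₗ a₀)) ∧
            typeRank G (Φ i₀) + typeRank G (Φ i₁) + rk * Module.finrank ℚ A =
              typeRank G (sigmaType Φ) + 1 + (rk₀ + rk₁) * Module.finrank ℚ A := by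
  let T : G → (Y → ℚ) →ₗ[ℚ] (Y → ℚ) := fun k => LinearMap.funLeft ℚ ℚ (fun y : Y => k • y)
  have h1 : ∃ i : G, T i = LinearMap.id :=
    ⟨1, LinearMap.ext fun f => funext fun y => by simp [T, LinearMap.funLeft_apply]⟩
  have hmul : ∀ i i' : G, ∃ i'' : G, T i'' = T i ∘ₗ T i' :=
    fun i i' => ⟨i' * i, LinearMap.ext fun f => funext fun y => by simp [T, LinearMap.funLeft_apply, mul_smul]⟩
  haveI : FiniteDimensional ℚ A := Submodule.finiteDimensional_of_le le_top
  obtain ⟨rk₀, rk₁, rk, m, hr₀', hr₁', hr', -, -⟩ := exists_rank_sum_elim T (𝒟 := 𝒟) (A := A) (fun L => h𝒟 L) h1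
    hmul (fun k a ha => hAst k a ha) (fun W hW hW0 hWst => hAirr W hW hW0 fun k f hf => hWst k f hf) hb₀ hb₁ ha₀ h0
  refine ⟨rk₀, rk₁, rk, hr₀', hr₁', hr', ?_⟩
  have hC := typeRank_add_typeRank_mul_add_eq_of_commutant h hI h01 r₀ r₁ hr₀ hr₁ hfine₀ hfine₁ h𝒟 hAst hAirr ι₀ ι₁
    hι₀eq hι₁eq hind₀ hind₁ hb₀ hb₁ hw₀ hw₁ ha₀ h0
  rw [hr₀', hr₁', hr'] at hC
  haveI : FiniteDimensional ℚ ↥(𝒟.map (LinearMap.applyₗ a₀)) :=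
    Submodule.finiteDimensional_of_le (map_applyₗ_le T (A := A) (fun L => h𝒟 L) ha₀)
  have hδ : 0 < Module.finrank ℚ ↥(𝒟.map (LinearMap.applyₗ a₀)) :=
    Nat.pos_of_ne_zero fun h' => map_applyₗ_ne_bot T (A := A) (fun L => h𝒟 L) h0 (Submodule.finrank_eq_zero.1 h')
  apply Nat.eq_of_mul_eq_mul_right hδ
  rw [add_mul, add_mul, add_mul]
  have e1 : rk * Module.finrank ℚ A * Module.finrank ℚ ↥(𝒟.map (LinearMap.applyₗ a₀)) =
      rk * Module.finrank ℚ ↥(𝒟.map (LinearMap.applyₗ a₀)) * Module.finrank ℚ A := by ring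
  have e2 : (rk₀ + rk₁) * Module.finrank ℚ A * Module.finrank ℚ ↥(𝒟.map (LinearMap.applyₗ a₀)) =
      (rk₀ * Module.finrank ℚ ↥(𝒟.map (LinearMap.applyₗ a₀)) +
        rk₁ * Module.finrank ℚ ↥(𝒟.map (LinearMap.applyₗ a₀))) * Module.finrank ℚ A := by ring
  rw [e1, e2, ← add_mul, hC]

end TypeRank

end Summit.HodgeConjecture.CorCM.IrrOdd

/-! ### §3 CM fields -/

namespace Summit.HodgeConjecture.CorCM

open CategoryTheory CategoryTheory.Limits NumberField Module IntermediateField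
open Literature.NumberTheory.ComplexMultiplication
open Literature.AlgebraicGeometry.Motives (AbelianVariety CMType)
open Literature.AlgebraicGeometry.Motives.AbelianVariety
open Literature.AlgebraicGeometry.HodgeTheory
open Literature.AlgebraicGeometry.ComplexMultiplication (IsCMTypeRealisation)
open Literature.AlgebraicGeometry.Pohlmann1968

variable {I : Type} [Fintype I] {K : I → Type} [∀ i, Field (K i)] [∀ i, NumberField (K i)] [∀ i, IsCMField (K i)]
  {T₀ : Type} [Field T₀] [NumberField T₀] {T₁ : Type} [Field T₁] [NumberField T₁]
  {Y : Type vY} [MulAction (ℂ ≃+* ℂ) Y] [Fintype Y]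

/-- **THE DEFECT IN D-RANKS (CM fields)**: in file C5's CM setting (`T₀ ⊆ K_{i₀}`, `T₁ ⊆ K_{i₁}` containing the traces,
both shadows assembled from ONE reference irreducible `A` with commutant `𝒟`, `δ = dim D·a₀`),
**`(cmTypeRank Φ₀ + cmTypeRank Φ₁)·δ + dim D⟨b ⊔ b′⟩·dim A = (cmFamilyRank Φ + 1)·δ + (dim D⟨b⟩ + dim D⟨b′⟩)·dim A`**.
[cite: Gordon1999HodgeAVSurvey, §3 Theorem, 7.5–7.7 and 9.4.3] [cite: Lang2002, XVII §3] [cite: Serre1977, §2.6] -/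
theorem cmTypeRank_add_cmTypeRank_mul_add_eq_of_commutant {i₀ i₁ : I} (h01 : i₀ ≠ i₁) (hI : ∀ l, l = i₀ ∨ l = i₁)
    (Φ : ∀ i, CMType (K i)) [Algebra T₀ (K i₀)] [Algebra T₁ (K i₁)]
    (htr₀ : ∀ (a : K i₀ →+* ℂ) (k : K i₀), a k ∈ normalClosure ℚ (K i₁) ℂ → k ∈ Set.range (algebraMap T₀ (K i₀)))
    (htr₁ : ∀ (b : K i₁ →+* ℂ) (k : K i₁), b k ∈ normalClosure ℚ (K i₀) ℂ → k ∈ Set.range (algebraMap T₁ (K i₁)))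
    {A : Submodule ℚ (Y → ℚ)} {𝒟 : Submodule ℚ ((Y → ℚ) →ₗ[ℚ] (Y → ℚ))}
    (h𝒟 : ∀ L : (Y → ℚ) →ₗ[ℚ] (Y → ℚ), L ∈ 𝒟 ↔ (∀ a ∈ A, L a ∈ A) ∧
      ∀ (k : ℂ ≃+* ℂ) (a : Y → ℚ), a ∈ A → L (fun y => a (k • y)) = fun y => L a (k • y))
    (hAst : ∀ (k : ℂ ≃+* ℂ) (a : Y → ℚ), a ∈ A → (fun y => a (k • y)) ∈ A)
    (hAirr : ∀ W : Submodule ℚ (Y → ℚ), W ≤ A → W ≠ ⊥ →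
      (∀ (k : ℂ ≃+* ℂ) (f : Y → ℚ), f ∈ W → (fun y => f (k • y)) ∈ W) → W = A)
    {J₀ J₁ : Type} [Fintype J₀] [Fintype J₁]
    (ι₀ : J₀ → ((Y → ℚ) →ₗ[ℚ] ((T₀ →+* ℂ) → ℚ))) (ι₁ : J₁ → ((Y → ℚ) →ₗ[ℚ] ((T₁ →+* ℂ) → ℚ)))
    (hι₀eq : ∀ (j : J₀) (k : ℂ ≃+* ℂ) (a : Y → ℚ), a ∈ A → ι₀ j (fun y => a (k • y)) = fun y => ι₀ j a (k • y))
    (hι₁eq : ∀ (j : J₁) (k : ℂ ≃+* ℂ) (a : Y → ℚ), a ∈ A → ι₁ j (fun y => a (k • y)) = fun y => ι₁ j a (k • y))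
    (hind₀ : ∀ f : J₀ → (Y → ℚ), (∀ j, f j ∈ A) → ∑ j, ι₀ j (f j) = 0 → ∀ j, f j = 0)
    (hind₁ : ∀ f : J₁ → (Y → ℚ), (∀ j, f j ∈ A) → ∑ j, ι₁ j (f j) = 0 → ∀ j, f j = 0)
    {b₀ : J₀ → (Y → ℚ)} {b₁ : J₁ → (Y → ℚ)} (hb₀ : ∀ j, b₀ j ∈ A) (hb₁ : ∀ j, b₁ j ∈ A)
    (hw₀ : (fun y : T₀ →+* ℂ => ∑ t ∈ Finset.univ.filter (fun t : K i₀ →+* ℂ => t.comp (algebraMap T₀ (K i₀)) = y),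
        antiVec (Φ i₀).1 (1 : ℂ ≃+* ℂ) t) = ∑ j, ι₀ j (b₀ j))
    (hw₁ : (fun y : T₁ →+* ℂ => ∑ t ∈ Finset.univ.filter (fun t : K i₁ →+* ℂ => t.comp (algebraMap T₁ (K i₁)) = y),
        antiVec (Φ i₁).1 (1 : ℂ ≃+* ℂ) t) = ∑ j, ι₁ j (b₁ j))
    {a₀ : Y → ℚ} (ha₀ : a₀ ∈ A) (h0 : a₀ ≠ 0) :
    (cmTypeRank (Φ i₀) + cmTypeRank (Φ i₁)) * Module.finrank ℚ ↥(𝒟.map (LinearMap.applyₗ a₀)) +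
        Module.finrank ℚ ↥(⨆ s, 𝒟.map (LinearMap.applyₗ (Sum.elim b₀ b₁ s))) * Module.finrank ℚ A =
      (CMAlgebra.cmFamilyRank Φ + 1) * Module.finrank ℚ ↥(𝒟.map (LinearMap.applyₗ a₀)) +
        (Module.finrank ℚ ↥(⨆ j, 𝒟.map (LinearMap.applyₗ (b₀ j))) +
            Module.finrank ℚ ↥(⨆ j, 𝒟.map (LinearMap.applyₗ (b₁ j)))) * Module.finrank ℚ A := by
  haveI : ∀ i, Nonempty (K i →+* ℂ) := fun i => inferInstance
  exact IrrOdd.typeRank_add_typeRank_mul_add_eq_of_commutant (G := ℂ ≃+* ℂ) (E := fun i => K i →+* ℂ)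
    (Φ := fun i => (Φ i).1) (fun i => isCMTypeWith_conj (Φ i)) hI h01
    (fun t : K i₀ →+* ℂ => t.comp (algebraMap T₀ (K i₀))) (fun t : K i₁ →+* ℂ => t.comp (algebraMap T₁ (K i₁)))
    (fun _ _ => rfl) (fun _ _ => rfl) (exists_stab_smul_eq_of_comp_eq_of_trace_le i₁ htr₀)
    (exists_stab_smul_eq_of_comp_eq_of_trace_le i₀ htr₁) h𝒟 hAst hAirr ι₀ ι₁ hι₀eq hι₁eq hind₀ hind₁ hb₀ hb₁
    hw₀ hw₁ ha₀ h0

/-- **THE DEFECT IS `(r + r′ − r″)·dim A` (CM fields)**: with `r, r′, r″` the D-ranks of the component tuples `b`,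
`b′`, `b ⊔ b′`, **`cmTypeRank Φ₀ + cmTypeRank Φ₁ + r″·dim A = cmFamilyRank Φ + 1 + (r + r′)·dim A`** —
`dim Hg(A₀) + dim Hg(A₁) − dim Hg(A₀ × A₁) = (r + r′ − r″)·dim A`, gen 70's I10 for ANY commutant.
[cite: Gordon1999HodgeAVSurvey, §3 Theorem, 7.5–7.7 and 9.4.3] [cite: Lang2002, XVII §1 and §3] -/
theorem cmTypeRank_add_cmTypeRank_add_rank_mul_eq_of_commutant {i₀ i₁ : I} (h01 : i₀ ≠ i₁)
    (hI : ∀ l, l = i₀ ∨ l = i₁) (Φ : ∀ i, CMType (K i)) [Algebra T₀ (K i₀)] [Algebra T₁ (K i₁)]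
    (htr₀ : ∀ (a : K i₀ →+* ℂ) (k : K i₀), a k ∈ normalClosure ℚ (K i₁) ℂ → k ∈ Set.range (algebraMap T₀ (K i₀)))
    (htr₁ : ∀ (b : K i₁ →+* ℂ) (k : K i₁), b k ∈ normalClosure ℚ (K i₀) ℂ → k ∈ Set.range (algebraMap T₁ (K i₁)))
    {A : Submodule ℚ (Y → ℚ)} {𝒟 : Submodule ℚ ((Y → ℚ) →ₗ[ℚ] (Y → ℚ))}
    (h𝒟 : ∀ L : (Y → ℚ) →ₗ[ℚ] (Y → ℚ), L ∈ 𝒟 ↔ (∀ a ∈ A, L a ∈ A) ∧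
      ∀ (k : ℂ ≃+* ℂ) (a : Y → ℚ), a ∈ A → L (fun y => a (k • y)) = fun y => L a (k • y))
    (hAst : ∀ (k : ℂ ≃+* ℂ) (a : Y → ℚ), a ∈ A → (fun y => a (k • y)) ∈ A)
    (hAirr : ∀ W : Submodule ℚ (Y → ℚ), W ≤ A → W ≠ ⊥ →
      (∀ (k : ℂ ≃+* ℂ) (f : Y → ℚ), f ∈ W → (fun y => f (k • y)) ∈ W) → W = A)
    {J₀ J₁ : Type} [Fintype J₀] [Fintype J₁]
    (ι₀ : J₀ → ((Y → ℚ) →ₗ[ℚ] ((T₀ →+* ℂ) → ℚ))) (ι₁ : J₁ → ((Y → ℚ) →ₗ[ℚ] ((T₁ →+* ℂ) → ℚ)))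
    (hι₀eq : ∀ (j : J₀) (k : ℂ ≃+* ℂ) (a : Y → ℚ), a ∈ A → ι₀ j (fun y => a (k • y)) = fun y => ι₀ j a (k • y))
    (hι₁eq : ∀ (j : J₁) (k : ℂ ≃+* ℂ) (a : Y → ℚ), a ∈ A → ι₁ j (fun y => a (k • y)) = fun y => ι₁ j a (k • y))
    (hind₀ : ∀ f : J₀ → (Y → ℚ), (∀ j, f j ∈ A) → ∑ j, ι₀ j (f j) = 0 → ∀ j, f j = 0)
    (hind₁ : ∀ f : J₁ → (Y → ℚ), (∀ j, f j ∈ A) → ∑ j, ι₁ j (f j) = 0 → ∀ j, f j = 0)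
    {b₀ : J₀ → (Y → ℚ)} {b₁ : J₁ → (Y → ℚ)} (hb₀ : ∀ j, b₀ j ∈ A) (hb₁ : ∀ j, b₁ j ∈ A)
    (hw₀ : (fun y : T₀ →+* ℂ => ∑ t ∈ Finset.univ.filter (fun t : K i₀ →+* ℂ => t.comp (algebraMap T₀ (K i₀)) = y),
        antiVec (Φ i₀).1 (1 : ℂ ≃+* ℂ) t) = ∑ j, ι₀ j (b₀ j))
    (hw₁ : (fun y : T₁ →+* ℂ => ∑ t ∈ Finset.univ.filter (fun t : K i₁ →+* ℂ => t.comp (algebraMap T₁ (K i₁)) = y),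
        antiVec (Φ i₁).1 (1 : ℂ ≃+* ℂ) t) = ∑ j, ι₁ j (b₁ j))
    {a₀ : Y → ℚ} (ha₀ : a₀ ∈ A) (h0 : a₀ ≠ 0) :
    ∃ rk₀ rk₁ rk : ℕ,
      Module.finrank ℚ ↥(⨆ j, 𝒟.map (LinearMap.applyₗ (b₀ j))) =
          rk₀ * Module.finrank ℚ ↥(𝒟.map (LinearMap.applyₗ a₀)) ∧
        Module.finrank ℚ ↥(⨆ j, 𝒟.map (LinearMap.applyₗ (b₁ j))) =
            rk₁ * Module.finrank ℚ ↥(𝒟.map (LinearMap.applyₗ a₀)) ∧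
          Module.finrank ℚ ↥(⨆ s, 𝒟.map (LinearMap.applyₗ (Sum.elim b₀ b₁ s))) =
              rk * Module.finrank ℚ ↥(𝒟.map (LinearMap.applyₗ a₀)) ∧
            cmTypeRank (Φ i₀) + cmTypeRank (Φ i₁) + rk * Module.finrank ℚ A =
              CMAlgebra.cmFamilyRank Φ + 1 + (rk₀ + rk₁) * Module.finrank ℚ A := by
  haveI : ∀ i, Nonempty (K i →+* ℂ) := fun i => inferInstance
  exact IrrOdd.typeRank_add_typeRank_add_rank_mul_eq_of_commutant (G := ℂ ≃+* ℂ) (E := fun i => K i →+* ℂ)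
    (Φ := fun i => (Φ i).1) (fun i => isCMTypeWith_conj (Φ i)) hI h01
    (fun t : K i₀ →+* ℂ => t.comp (algebraMap T₀ (K i₀))) (fun t : K i₁ →+* ℂ => t.comp (algebraMap T₁ (K i₁)))
    (fun _ _ => rfl) (fun _ _ => rfl) (exists_stab_smul_eq_of_comp_eq_of_trace_le i₁ htr₀)
    (exists_stab_smul_eq_of_comp_eq_of_trace_le i₀ htr₁) h𝒟 hAst hAirr ι₀ ι₁ hι₀eq hι₁eq hind₀ hind₁ hb₀ hb₁
    hw₀ hw₁ ha₀ h0

end Summit.HodgeConjecture.CorCM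

end
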